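import Literature.AlgebraicGeometry.Morphisms.CechUnitCocycleSmallExtensionResidue
import Literature.AlgebraicGeometry.Morphisms.SectionsAffineBaseChange
import Literature.AlgebraicGeometry.Morphisms.CechH1Pullback
import HarnessLib

/-!
# The difference class of two lifts READ ON THE FIBRE: a Čech `1`-cocycle of `𝒪_{X_k}` on `X_k = X ×_A Spec k`, zero iff
# the lifts are cohomologous (Görtz–Wedhorn II, Lemma 26.15 / Lemma 24.72 Step (I); Hartshorne DT Thm. 6.4 (b))

Layer `Literature/AlgebraicGeometry/Morphisms`, namespace `Literature.AlgebraicGeometry.Morphisms.CechUnitCocycle`.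
THEOREMS ONLY (no definition, no named fact, no instance, no notation).  Cell `hodgecm-mathlib` (D-0151), F-2d road (R-def)
«theorem of the cube over a non-reduced base by Artinian induction», Step (I) brick Č2 (author B-p07 (g15); sequel of Č1 ★
`CechUnitCocycleSmallExtensionResidue`).

Č1 reads the difference of two unit cocycles `u, u'` over `R` with the same reduction along a small extension `R ↠ R₀` (residue
algebra `k`, `e : k^d ≅ I`) as a `d`-tuple `η` of Čech `1`-cocycles of the RESIDUE MODELS `Γ(V) ⊗_A k`.  For the scheme
`f : X → Spec A` and the cartesian square `g : Z = X ×_A Spec k → X` (`fZ : Z → Spec k`, ★ `IsPullback g fZ f (Spec (A → k))`)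
the residue models ARE the sections of the fibre on affine opens: ★ `bcSections` (`B ⊗_A Γ(X, V) → Γ(Z, g⁻¹V)`, bijective for
`V` affine and ANY `A → B`, ★ `bcSections_bijective_of_isAffineOpen`, B-p10).  This file transports `η` to an honest Čech
`1`-cocycle of `𝒪_Z` on the cover `g⁻¹𝒰` (★ `Morphisms/CechH1`: `cechZ1`, `CechH1`) and proves: **its class in `Ȟ¹(g⁻¹𝒰, 𝒪_Z)^d`
vanishes iff `u'` is obtained from `u` by a unit `0`-cochain reducing to `1`** (for `𝒰` with affine members), i.e.
[Hartshorne2010] Thm. 6.4 (b) «`H¹(J ⊗ 𝒪_X) = H¹(X₀, 𝒪)^d` acts (simply) transitively on the lifts» in the Čech currency of ★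
`kunneth_cechH1_slices_injective` and ★ `cechComapH1` — the currency in which Step (I) of [GortzWedhorn2023] Lemma 24.72
kills the class on the slices.

* §1 the model map `Γ(V) ⊗_A k → Γ(Z, W)` (`W ⊆ g⁻¹V`) = ★ `bcSections` after `TensorProduct.comm`, spelled inline:
  `bcSections_comm_tmul`, `res_bcSections_comm` (compatible with restriction), `bcSections_comm_bijective` (affine `V`),
  `bcSections_comm_inf_injective` (into the open `g⁻¹U_i ∩ g⁻¹U_j` of the fibre cover, affine `U_i ∩ U_j`).
* §2 **`bcSections_comm_mem_cechZ1`** — a difference cochain `η` of `(u, u')` (Č1: `u'_{ij} = u_{ij}(1 + κ η_{ij})`) read on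
  the fibre is a Čech `1`-COCYCLE of `𝒪_Z` on `g⁻¹𝒰` (Č1 `diffCochainK_cocycle`).
* §3 **`exists_rel_of_fibreClass_eq_zero`** — if the `U_i` and `U_i ∩ U_j` are AFFINE and every class
  `[η_ℓ^fibre] ∈ Ȟ¹(g⁻¹𝒰, 𝒪_Z)` is zero, then `u'` is cohomologous to `u` by a unit `0`-cochain reducing to `1` (pull the
  `0`-cochain back through the affine bijections; Č1 `exists_rel_of_diffCochainK_eq_cechD0`); **`fibreClass_eq_zero_of_rel`**
  — the converse (Č1 `exists_eq_cechD0_of_rel`), any cover.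

HC_CM is proved only modulo the 7 printed citations until rung 0 closes; nothing here is about HC.

## References
* [GortzWedhorn2023] U. Görtz, T. Wedhorn, *Algebraic Geometry II* (2023), Lemma 26.15, Lemma 24.72 proof Step (I) (p. 409).
* [Hartshorne2010] R. Hartshorne, *Deformation Theory*, GTM 257 (2010), §6 Thm. 6.4 (b) and proof (pp. 50–51).
* [GortzWedhorn2020] U. Görtz, T. Wedhorn, *Algebraic Geometry I*, 2nd ed. (2020), Prop. 4.20 (affine base change of sections).
* [StacksProject] The Stacks Project, Tag 02KH (degree `0`), Tag 01ED (Čech cohomology).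
-/

noncomputable section

universe u v

open TensorProduct CategoryTheory AlgebraicGeometry
open Literature.RingTheory.Flat Literature.RingTheory.Flat.IsSmallExtension

namespace Literature.AlgebraicGeometry.Morphisms

namespace CechUnitCocycle

variable {A : Type u} [CommRing A] {X Z : Scheme.{u}} {f : X ⟶ Spec (.of A)} {ι : Type v} {U : ι → X.Opens}
variable {k : Type u} [CommRing k] [Algebra A k] {fZ : Z ⟶ Spec (.of k)} {g : Z ⟶ X}
  (hg : g ≫ f = restrictBase A fZ)

/-! ## §1 The residue models are the sections of the fibre -/

section ToFibre

/-- `g⁻¹U_i ∩ g⁻¹U_j ⊆ g⁻¹(U_i ∩ U_j)` (private plumbing, as in ★ `CechH1FlatBaseChange`). [folklore] -/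
private theorem preimageFamily_inf_le' (g : Z ⟶ X) (U : ι → X.Opens) (i j : ι) :
    preimageFamily g U i ⊓ preimageFamily g U j ≤ g ⁻¹ᵁ (U i ⊓ U j) :=
  fun _ hx => hx

/-- `g⁻¹(U_i ∩ U_j) ⊆ g⁻¹U_i ∩ g⁻¹U_j` (private plumbing). [folklore] -/
private theorem preimage_inf_le_preimageFamily_inf (g : Z ⟶ X) (U : ι → X.Opens) (i j : ι) :
    g ⁻¹ᵁ (U i ⊓ U j) ≤ preimageFamily g U i ⊓ preimageFamily g U j :=
  fun _ hx => hx

/-- **The residue model `Γ(V) ⊗_A k` maps to the sections `Γ(Z, W)` of the fibre** (`W ⊆ g⁻¹V`): `s ⊗ c ↦ f_Z^*(c)|_W · g^*(s)|_W`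
(★ `bcSections` precomposed with `TensorProduct.comm`; spelled inline below — this lemma is its value on pure tensors).
[cite: StacksProject, Tag 02KH (degree 0)] -/
theorem bcSections_comm_tmul {V : X.Opens} {W : Z.Opens} (e : W ≤ g ⁻¹ᵁ V) (s : Sections f V) (c : k) :
    (bcSections f fZ g hg e).comp (Algebra.TensorProduct.comm A (Sections f V) k).toAlgHom (s ⊗ₜ c) =
      toSectionsBase A fZ W c * Sections.comap f (restrictBase A fZ) g hg e s := by
  change bcSections f fZ g hg e (Algebra.TensorProduct.comm A (Sections f V) k (s ⊗ₜ c)) = _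
  rw [Algebra.TensorProduct.comm_tmul]
  exact Algebra.TensorProduct.productMap_apply_tmul _ _ c s

/-- **Compatibility with restriction**: `(x|_{V'})^fibre = (x^fibre)|_{W'}` for `W' ⊆ W`, `W' ⊆ g⁻¹V'`, `V' ⊆ V`.
[cite: StacksProject, Tag 02KH (degree 0)] -/
theorem res_bcSections_comm {V V' : X.Opens} {W W' : Z.Opens} (e : W ≤ g ⁻¹ᵁ V) (e' : W' ≤ g ⁻¹ᵁ V') (hV : V' ≤ V)
    (hW : W' ≤ W) (x : Sections f V ⊗[A] k) :
    Sections.res (restrictBase A fZ) hW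
        ((bcSections f fZ g hg e).comp (Algebra.TensorProduct.comm A (Sections f V) k).toAlgHom x) =
      (bcSections f fZ g hg e').comp (Algebra.TensorProduct.comm A (Sections f V') k).toAlgHom (resR f k hV x) := by
  induction x using TensorProduct.induction_on with
  | zero => simp only [map_zero]
  | tmul s c =>
      rw [resR_tmul, bcSections_comm_tmul, bcSections_comm_tmul, map_mul, Sections.res_comap, Sections.comap_res]
      congr 1
      exact (Sections.res fZ hW).commutes c
  | add x y hx hy => simp only [map_add, hx, hy]

/-- `resR` along `le_refl` is the identity. [cite: StacksProject, Tag 02KE] -/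
theorem resR_le_refl (V : X.Opens) (x : Sections f V ⊗[A] k) : resR f k (le_refl V) x = x := by
  induction x using TensorProduct.induction_on with
  | zero => simp only [map_zero]
  | tmul s c => rw [resR_tmul, Sections.res_self]
  | add x y hx hy => simp only [map_add, hx, hy]

/-- **On an AFFINE `V` the residue model IS `Γ(Z, g⁻¹V)`**: the map is bijective for any `A → k` (★
`bcSections_bijective_of_isAffineOpen`). [cite: GortzWedhorn2020, Prop. 4.20] [cite: StacksProject, Tag 02KH (degree 0)] -/
theorem bcSections_comm_bijective (H : IsPullback g fZ f (Spec.map (CommRingCat.ofHom (algebraMap A k)))) {V : X.Opens}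
    (hV : IsAffineOpen V) :
    Function.Bijective
      ((bcSections f fZ g H.w (le_refl (g ⁻¹ᵁ V))).comp (Algebra.TensorProduct.comm A (Sections f V) k).toAlgHom) :=
  (bcSections_bijective_of_isAffineOpen f fZ g H hV).comp (Algebra.TensorProduct.comm A (Sections f V) k).bijective

/-- **Injectivity on an affine intersection, read in `Γ(Z, g⁻¹U_i ∩ g⁻¹U_j)`** (the open of the fibre cover): the model map
into `Γ(Z, g⁻¹U_i ∩ g⁻¹U_j)` is the bijection onto `Γ(Z, g⁻¹(U_i ∩ U_j))` followed by a restriction between EQUAL opens, which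
is injective (it has the opposite restriction as a left inverse). [cite: StacksProject, Tag 02KH (degree 0)] -/
theorem bcSections_comm_inf_injective (H : IsPullback g fZ f (Spec.map (CommRingCat.ofHom (algebraMap A k)))) (i j : ι)
    (hU2 : IsAffineOpen (U i ⊓ U j)) :
    Function.Injective ((bcSections f fZ g H.w (preimageFamily_inf_le' g U i j)).comp
      (Algebra.TensorProduct.comm A (Sections f (U i ⊓ U j)) k).toAlgHom) := by
  intro x y hxy
  apply (bcSections_comm_bijective H hU2).1
  -- restrict back along `g⁻¹(U_i ∩ U_j) ≤ g⁻¹U_i ∩ g⁻¹U_j`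
  have key := congrArg (Sections.res (restrictBase A fZ) (preimage_inf_le_preimageFamily_inf g U i j)) hxy
  rw [res_bcSections_comm H.w _ (le_refl _) (le_refl _), res_bcSections_comm H.w _ (le_refl _) (le_refl _),
    resR_le_refl, resR_le_refl] at key
  exact key

end ToFibre

/-! ## §2 A difference cochain read on the fibre is a Čech `1`-cocycle of `𝒪_Z` -/

section Cocycle

variable {R R₀ : Type u} [CommRing R] [CommRing R₀] [Algebra A R] [Algebra A R₀]
  {π : R →ₐ[A] R₀} {ρ : R →ₐ[A] k} {I : Ideal R} {d : ℕ} {e : (Fin d → k) ≃ₗ[A] I}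
  (H : IsSmallExtension π ρ I e) {ρ₀ : R₀ →ₐ[A] k} (hρ : ρ₀.comp π = ρ)
  [∀ V : X.Opens, Module.Flat A (Sections f V)]

include H hρ in
/-- **A difference cochain of two lifts, read on the fibre, is a Čech `1`-COCYCLE of `𝒪_Z` on `g⁻¹𝒰`** (Č1 `diffCochainK_cocycle`
transported along §1). [cite: GortzWedhorn2023, Lemma 26.15] [cite: Hartshorne2010, §6 Thm. 6.4 (b) and proof (pp. 50–51)]
(Edition note: the hypothesis `[∀ V : X.Opens, Module.Flat A (Sections f V)]` of this head holds when `A` is a field but is vacuous for a non-constant flat family `X/Spec A`; use `fibreCochain_mem_cechZ1` of `CechUnitCocycleResidueAffineCover`, which assumes flatness of the sections over the affine opens of the cover only.) -/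
theorem bcSections_comm_mem_cechZ1 (u u' : UCocycle f U R) (η : Fin d → (i j : ι) → Sections f (U i ⊓ U j) ⊗[A] k)
    (hη : ∀ i j, u'.val i j = u.val i j * (1 + kerMap e _ (fun ℓ => η ℓ i j))) (ℓ : Fin d) :
    (fun i j => (bcSections f fZ g hg (preimageFamily_inf_le' g U i j)).comp
        (Algebra.TensorProduct.comm A (Sections f (U i ⊓ U j)) k).toAlgHom (η ℓ i j) :
          CechC1 (restrictBase A fZ) (preimageFamily g U)) ∈
      cechZ1 (restrictBase A fZ) (preimageFamily g U) := by
  rw [mem_cechZ1_iff]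
  funext i j l
  have e3 : preimageFamily g U i ⊓ preimageFamily g U j ⊓ preimageFamily g U l ≤ g ⁻¹ᵁ (U i ⊓ U j ⊓ U l) :=
    fun _ hx => hx
  have key := congrArg ((bcSections f fZ g hg e3).comp
    (Algebra.TensorProduct.comm A (Sections f (U i ⊓ U j ⊓ U l)) k).toAlgHom) (diffCochainK_cocycle H hρ u u' η hη ℓ i j l)
  rw [map_zero, map_add, map_sub] at key
  rw [cechD1_apply]
  change Sections.res (restrictBase A fZ) _ _ - Sections.res (restrictBase A fZ) _ _ + Sections.res (restrictBase A fZ) _ _ =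
    (0 : CechC2 (restrictBase A fZ) (preimageFamily g U)) i j l
  rw [res_bcSections_comm hg _ e3 (le23 (U := U) i j l), res_bcSections_comm hg _ e3 (le13 (U := U) i j l),
    res_bcSections_comm hg _ e3 (le12 (U := U) i j l)]
  exact key

end Cocycle

/-! ## §3 Zero class on the fibre ⟺ cohomologous lifts -/

section Class

variable {R R₀ : Type u} [CommRing R] [CommRing R₀] [Algebra A R] [Algebra A R₀]
  {π : R →ₐ[A] R₀} {ρ : R →ₐ[A] k} {I : Ideal R} {d : ℕ} {e : (Fin d → k) ≃ₗ[A] I}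
  (H : IsSmallExtension π ρ I e) {ρ₀ : R₀ →ₐ[A] k} (hρ : ρ₀.comp π = ρ)
  [∀ V : X.Opens, Module.Flat A (Sections f V)]

include H hρ in
/-- **ZERO CLASS ON THE FIBRE ⟹ COHOMOLOGOUS LIFTS** (cover by AFFINE opens with affine pairwise intersections, e.g. affine
opens of a separated scheme): if every component of the difference cochain of `(u, u')` read on the fibre is a Čech
`1`-coboundary of `𝒪_Z` on `g⁻¹𝒰` — its class in `Ȟ¹(g⁻¹𝒰, 𝒪_Z)` vanishes — then `u'` is obtained from `u` by a unit
`0`-cochain reducing to `1` along `π`: the `0`-cochain on `Z` is pulled back to the residue models through the affine bijections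
`Γ(U_i) ⊗_A k ≅ Γ(Z, g⁻¹U_i)` (§1), the coboundary identity descends through injectivity on `U_i ∩ U_j`, and Č1
`exists_rel_of_diffCochainK_eq_cechD0` applies. [cite: Hartshorne2010, §6 Thm. 6.4 (b) and proof (pp. 50–51)]
[cite: GortzWedhorn2023, Lemma 24.72 proof Step (I) (p. 409)]
(Edition note: the hypothesis `[∀ V : X.Opens, Module.Flat A (Sections f V)]` of this head holds when `A` is a field but is vacuous for a non-constant flat family `X/Spec A`; use `exists_rel_of_fibreClass_eq_zero_of_isAffineOpen` of `CechUnitCocycleResidueAffineCover`, which assumes flatness of the sections over the affine opens of the cover only.) -/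
theorem exists_rel_of_fibreClass_eq_zero
    (HP : IsPullback g fZ f (Spec.map (CommRingCat.ofHom (algebraMap A k))))
    (hU : ∀ i, IsAffineOpen (U i)) (hU2 : ∀ i j, IsAffineOpen (U i ⊓ U j))
    (u u' : UCocycle f U R) (η : Fin d → (i j : ι) → Sections f (U i ⊓ U j) ⊗[A] k)
    (hη : ∀ i j, u'.val i j = u.val i j * (1 + kerMap e _ (fun ℓ => η ℓ i j)))
    (h0 : ∀ ℓ, CechH1.mk (restrictBase A fZ) (preimageFamily g U)
      ⟨_, bcSections_comm_mem_cechZ1 HP.w H hρ u u' η hη ℓ⟩ = 0) :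
    ∃ h : UCochain0 f U R, (∀ i, coef f π (U i) (h i : Sections f (U i) ⊗[A] R) = 1) ∧
      Rel u u' (fun i => (h i : Sections f (U i) ⊗[A] R)) := by
  -- `η_ℓ^fibre = d⁰ γ_ℓ` on `Z`
  have hB : ∀ ℓ, ∃ γ : CechC0 (restrictBase A fZ) (preimageFamily g U),
      cechD0 (restrictBase A fZ) (preimageFamily g U) γ =
        fun i j => (bcSections f fZ g HP.w (preimageFamily_inf_le' g U i j)).comp
          (Algebra.TensorProduct.comm A (Sections f (U i ⊓ U j)) k).toAlgHom (η ℓ i j) := fun ℓ => by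
    have h1 := (CechH1.mk_eq_zero_iff (restrictBase A fZ) (preimageFamily g U) _).1 (h0 ℓ)
    exact (mem_cechB1_iff (restrictBase A fZ) (preimageFamily g U) _).1 h1
  choose γ hγ using hB
  -- pull `γ_ℓ i` back to the residue model `Γ(U_i) ⊗_A k` through the affine bijection
  have hsurj : ∀ ℓ i, ∃ b : Sections f (U i) ⊗[A] k,
      (bcSections f fZ g HP.w (le_refl (g ⁻¹ᵁ (U i)))).comp (Algebra.TensorProduct.comm A (Sections f (U i)) k).toAlgHom b =
        γ ℓ i := fun ℓ i => (bcSections_comm_bijective HP (hU i)).2 (γ ℓ i)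
  choose β hβ using hsurj
  refine exists_rel_of_diffCochainK_eq_cechD0 H hρ u u' η hη β fun ℓ i j => ?_
  -- compare in `Γ(Z, g⁻¹U_i ∩ g⁻¹U_j)`, where the model map is injective (affine `U_i ∩ U_j`)
  apply bcSections_comm_inf_injective HP i j (hU2 i j)
  have e1 := congrFun (congrFun (hγ ℓ) i) j
  rw [cechD0_apply] at e1
  rw [← e1, map_sub, ← hβ ℓ i, ← hβ ℓ j]
  change Sections.res (restrictBase A fZ) _ _ - Sections.res (restrictBase A fZ) _ _ = _
  rw [res_bcSections_comm HP.w (le_refl _) (preimageFamily_inf_le' g U i j) (inf_le_right : U i ⊓ U j ≤ U j),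
    res_bcSections_comm HP.w (le_refl _) (preimageFamily_inf_le' g U i j) (inf_le_left : U i ⊓ U j ≤ U i)]

include H hρ in
/-- **COHOMOLOGOUS LIFTS ⟹ ZERO CLASS ON THE FIBRE** (any cover): if `u'` is obtained from `u` by a `0`-cochain reducing to `1`,
every difference cochain read on the fibre is a Čech coboundary of `𝒪_Z`, so its class in `Ȟ¹(g⁻¹𝒰, 𝒪_Z)` is `0` (Č1
`exists_eq_cechD0_of_rel` transported along §1). [cite: Hartshorne2010, §6 Thm. 6.4 (b) and proof (pp. 50–51)]
[cite: GortzWedhorn2023, Lemma 26.15]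
(Edition note: the hypothesis `[∀ V : X.Opens, Module.Flat A (Sections f V)]` of this head holds when `A` is a field but is vacuous for a non-constant flat family `X/Spec A`; use `fibreClass_eq_zero_of_rel_of_isAffineOpen` of `CechUnitCocycleResidueAffineCover`, which assumes flatness of the sections over the affine opens of the cover only.) -/
theorem fibreClass_eq_zero_of_rel (u u' : UCocycle f U R) (h : (i : ι) → Sections f (U i) ⊗[A] R)
    (h1 : ∀ i, coef f π _ (h i) = 1) (hr : Rel u u' h)
    (η : Fin d → (i j : ι) → Sections f (U i ⊓ U j) ⊗[A] k)
    (hη : ∀ i j, u'.val i j = u.val i j * (1 + kerMap e _ (fun ℓ => η ℓ i j))) (ℓ : Fin d) :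
    CechH1.mk (restrictBase A fZ) (preimageFamily g U) ⟨_, bcSections_comm_mem_cechZ1 hg H hρ u u' η hη ℓ⟩ = 0 := by
  obtain ⟨β, hβ⟩ := exists_eq_cechD0_of_rel H hρ u u' h h1 hr η hη
  apply (CechH1.mk_eq_zero_iff (restrictBase A fZ) (preimageFamily g U) _).2
  refine (mem_cechB1_iff (restrictBase A fZ) (preimageFamily g U) _).2
    ⟨fun i => (bcSections f fZ g hg (le_refl (g ⁻¹ᵁ (U i)))).comp
      (Algebra.TensorProduct.comm A (Sections f (U i)) k).toAlgHom (β ℓ i), ?_⟩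
  funext i j
  rw [cechD0_apply]
  change Sections.res (restrictBase A fZ) _ _ - Sections.res (restrictBase A fZ) _ _ =
    (bcSections f fZ g hg (preimageFamily_inf_le' g U i j)).comp
      (Algebra.TensorProduct.comm A (Sections f (U i ⊓ U j)) k).toAlgHom (η ℓ i j)
  rw [res_bcSections_comm hg (le_refl _) (preimageFamily_inf_le' g U i j) (inf_le_right : U i ⊓ U j ≤ U j),
    res_bcSections_comm hg (le_refl _) (preimageFamily_inf_le' g U i j) (inf_le_left : U i ⊓ U j ≤ U i), ← map_sub,
    ← hβ ℓ i j]

end Class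

end CechUnitCocycle

end Literature.AlgebraicGeometry.Morphisms

end
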